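import Summits.QuantumFields.YangMills.Theorems.InfiniteVolumePerOrderCompactness
import Summits.QuantumFields.YangMills.Theorems.InfiniteVolumeCentreBase
import HarnessLib

/-!
# Infinite volume by compactness with PER-ORDER collar constants: centre-smeared and base-point-smeared
# functionals have the same limits

Support file for `TypicalExteriorCeilings.FactorialCalibration` (stmt-QuantumFields-25894; also BY NAME
`AntiScreeningCeilings.FactorialCalibrationC`, stmt-QuantumFields-26673).  Verbatim re-run of steps 10–11 of the
landed infinite-volume engine (`InfiniteVolume.tendsto_tsum_shift_sub_base`, `tendsto_centre_sub_base_zero`,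
`tendsto_base_of_tendsto_centre`) for a PER-ORDER torus collar bound `(Cn n/R⁴)ⁿ` in place of the order-uniform
`MomentBounds6` currency.  The shift-defect estimate `norm_tsum_weight_shift_sub_le_of_zdCollar` is a per-order
statement, cited BY NAME with `C ↦ Cn n`.

WHAT IS PROVED ([folklore]; pure soft analysis): `tendsto_tsum_shift_sub_base`, `tendsto_centre_sub_base_zero`,
`tendsto_base_of_tendsto_centre` (per-order constants).

HONEST FRAMING: no statement about Bałaban's renormalisation group, RP, a mass gap or Clay; ceilings are HYPOTHESES;
no summit is proved (rung R2a plumbing).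

References: Glimm–Jaffe (1987) §6.1; Osterwalder–Schrader CMP 42 (1975) §2.
-/

set_option autoImplicit false

noncomputable section

open scoped BigOperators SchwartzMap
open MeasureTheory Filter Topology
open Literature.MathematicalPhysics.QuantumFieldTheory hiding ZdEdge
open Literature.MathematicalPhysics.QuantumLattice
open Literature.MathematicalPhysics.AQFT
open Literature.Probability.LatticeModels (box Site)
open Summit.QuantumFields.YangMills.Cruxes.OSLegsFromFemtoAndGap.DlrCollarTransfer
  (plane torusE exists_abs_plane_le)

namespace Summit.QuantumFields.YangMills.Theorems.InfiniteVolume.PerOrder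

variable {G : Type} [Group G] [TopologicalSpace G] [IsTopologicalGroup G] [CompactSpace G]
  [MeasurableSpace G] [BorelSpace G]

/-- **The shift defect tends to zero along an admissible sequence, per-order constants** (verbatim
`InfiniteVolume.tendsto_tsum_shift_sub_base` with `C ↦ Cn n`). [folklore] -/
theorem tendsto_tsum_shift_sub_base (r : LatticeRep G) {a : ℝ → ℝ} (Cn : ℕ → ℝ) {β₄ ℓ₄ : ℝ} (hℓ : 0 < ℓ₄)
    (hC : ∀ n, 0 ≤ Cn n)
    (Hcol : ∀ β : ℝ, β₄ ≤ β →
      ∀ (L n : ℕ) (q : Fin n → Fin 4 × Fin 4) (x : Fin n → (Fin 4 → ℤ)) (R : ℕ), (∀ i, (q i).1 < (q i).2) →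
        1 ≤ R → (R : ℝ) * a β ≤ ℓ₄ → 4 * R + 8 ≤ L →
        (∀ i j : Fin n, i ≠ j → ∃ k : Fin 4,
          (2 * (R : ℤ) + 4) ≤ |((((x i k - x j k : ℤ) : ZMod (2 * L + 1))).valMinAbs : ℤ)|) →
        |torusE G r β L (fun U => ∏ i, (plane G r (q i) (x i) U - torusE G r β L (plane G r (q i) (x i))))| ≤
          (Cn n / (R : ℝ) ^ 4) ^ n)
    (β : ℕ → ℝ) (hβ : ∀ k, β₄ ≤ β k) (ha : ∀ k, 0 < a (β k)) (ha24 : ∀ k, a (β k) ≤ 1 / 24)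
    (haℓ : ∀ k, a (β k) ≤ ℓ₄) (ha0 : Tendsto (fun k => a (β k)) atTop (𝓝 0))
    (μ : ℕ → Measure (LGConfig 4 G)) (hμ : ∀ k, μ k ∈ oddTorusLimitPoints r (β k))
    {n : ℕ} (hn : 2 ≤ n) (q : Fin n → Fin 4 × Fin 4) (hq : ∀ i, (q i).1 < (q i).2)
    (c : ℕ → Fin n → EuclideanSpace ℝ (Fin 4)) (hc : ∀ k l, ‖c k l‖ ≤ a (β k))
    (F : 𝓢((Fin n → EuclideanSpace ℝ (Fin 4)), ℂ)) (hF : IsOffDiagonal F) :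
    Tendsto (fun k => ∑' x : Fin n → Site 4,
        (((∫ U, ∏ i, (plane G r (q i) (x i) U - ∫ V, plane G r (q i) (x i) V ∂(μ k)) ∂(μ k) : ℝ) : ℂ)) *
          F (fun l => a (β k) • siteToE (x l) + c k l) -
      ∑' x : Fin n → Site 4,
        (((∫ U, ∏ i, (plane G r (q i) (x i) U - ∫ V, plane G r (q i) (x i) V ∂(μ k)) ∂(μ k) : ℝ) : ℂ)) *
          F (fun l => a (β k) • siteToE (x l))) atTop (𝓝 0) := by
  obtain ⟨Cp, hCp⟩ := exists_abs_plane_le (G := G) r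
  have hCp0 : 0 ≤ Cp := le_trans (abs_nonneg _) (hCp (0, 1) 0 (fun _ => 1))
  haveI : ∀ k, IsProbabilityMeasure (μ k) := fun k => by
    obtain ⟨S', -, hlim⟩ := hμ k
    exact hlim.1
  have ha1 : ∀ k, a (β k) ≤ 1 := fun k => (ha24 k).trans (by norm_num)
  set KK : ℝ := (((Cp + Cp) * 4 ^ 4 * 5 ^ 6 + (Cp + Cp) * 2 ^ 6 * (10 + 2 * (0 + 1)) ^ 4 +
      16 * Cn n * 2 ^ 6 * (2 / ℓ₄ + 48) ^ 4) * 2 ^ 6 * (81 * ∑' m : ℕ, (((m : ℝ) + 1) ^ 2)⁻¹)) ^ n with hKK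
  have hKK0 : 0 ≤ KK := by
    have : 0 ≤ ∑' m : ℕ, (((m : ℝ) + 1) ^ 2)⁻¹ := tsum_nonneg fun m => by positivity
    have := hC n
    positivity
  -- the shift defect at level `k` is at most `2 ‖c k‖ KK (5 ‖F‖)`
  have hdef : ∀ k, ‖∑' x : Fin n → Site 4,
        (((∫ U, ∏ i, (plane G r (q i) (x i) U - ∫ V, plane G r (q i) (x i) V ∂(μ k)) ∂(μ k) : ℝ) : ℂ)) *
          F (fun l => a (β k) • siteToE (x l) + c k l) -
      ∑' x : Fin n → Site 4,
        (((∫ U, ∏ i, (plane G r (q i) (x i) U - ∫ V, plane G r (q i) (x i) V ∂(μ k)) ∂(μ k) : ℝ) : ℂ)) *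
          F (fun l => a (β k) • siteToE (x l))‖ ≤ 2 * ‖c k‖ * KK * (5 * schwartzNorm (10 * n + 1) F) := by
    intro k
    have h := norm_tsum_weight_shift_sub_le_of_zdCollar (s₁ := 0) (s₂ := 1) hℓ (hC n)
      (by positivity : 0 ≤ Cp + Cp)
      (fun x => ∫ U, ∏ i, (plane G r (q i) (x i) U - ∫ V, plane G r (q i) (x i) V ∂(μ k)) ∂(μ k))
      (fun x => abs_infVolWeight_le r hCp (μ k) q x)
      (fun x R hR hRa hsep => momentBound_oddTorusLimitPoints r Cn Hcol (hβ k) (hμ k) q x R hq hR hRa hsep)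
      (ha k) (ha1 k) (haℓ k) hn le_rfl zero_le_one (by norm_num) (by linarith [ha24 k]) F hF
      (fun x l => a (β k) • siteToE (x l)) (fun x l => by simp) (c k) (fun l => by rw [one_mul]; exact hc k l)
    have heq : ∀ x : Fin n → Site 4, ((fun l => a (β k) • siteToE (x l)) + c k) =
        fun l => a (β k) • siteToE (x l) + c k l := fun x => by
      funext l; simp only [Pi.add_apply]
    simp only [heq] at h
    exact h
  -- `‖c k‖ ≤ a (β k) → 0`
  have hck : ∀ k, ‖c k‖ ≤ a (β k) := fun k => by
    refine (pi_norm_le_iff_of_nonneg (ha k).le).2 fun l => hc k l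
  rw [NormedAddGroup.tendsto_nhds_zero]
  intro ε hε
  have hlim : Tendsto (fun k => 2 * a (β k) * KK * (5 * schwartzNorm (10 * n + 1) F)) atTop (𝓝 0) := by
    have := ((ha0.const_mul 2).mul_const KK).mul_const (5 * schwartzNorm (10 * n + 1) F)
    simpa using this
  filter_upwards [(NormedAddGroup.tendsto_nhds_zero.1 hlim) ε hε] with k hk
  have hnn : 0 ≤ 2 * a (β k) * KK * (5 * schwartzNorm (10 * n + 1) F) := by
    have := schwartzNorm_nonneg (10 * n + 1) F
    have := (ha k).le
    positivity
  rw [Real.norm_of_nonneg hnn] at hk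
  calc _ ≤ 2 * ‖c k‖ * KK * (5 * schwartzNorm (10 * n + 1) F) := hdef k
    _ ≤ 2 * a (β k) * KK * (5 * schwartzNorm (10 * n + 1) F) := by
        have := schwartzNorm_nonneg (10 * n + 1) F
        gcongr
        exact hck k
    _ < ε := hk

/-- **Centre minus base `→ 0` along any DATA-type sequence, per-order constants** (verbatim
`InfiniteVolume.tendsto_centre_sub_base_zero`). [folklore] -/
theorem tendsto_centre_sub_base_zero (r : LatticeRep G) {a : ℝ → ℝ} (hapos : ∀ β, 0 < a β)
    (ha0 : Tendsto a atTop (𝓝 0)) (Cn : ℕ → ℝ) {β₄ ℓ₄ : ℝ} (hℓ : 0 < ℓ₄) (hC : ∀ n, 0 ≤ Cn n)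
    (Hcol : ∀ β : ℝ, β₄ ≤ β →
      ∀ (L n : ℕ) (q : Fin n → Fin 4 × Fin 4) (x : Fin n → (Fin 4 → ℤ)) (R : ℕ), (∀ i, (q i).1 < (q i).2) →
        1 ≤ R → (R : ℝ) * a β ≤ ℓ₄ → 4 * R + 8 ≤ L →
        (∀ i j : Fin n, i ≠ j → ∃ k : Fin 4,
          (2 * (R : ℤ) + 4) ≤ |((((x i k - x j k : ℤ) : ZMod (2 * L + 1))).valMinAbs : ℤ)|) →
        |torusE G r β L (fun U => ∏ i, (plane G r (q i) (x i) U - torusE G r β L (plane G r (q i) (x i))))| ≤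
          (Cn n / (R : ℝ) ^ 4) ^ n)
    (β : ℕ → ℝ) (hβ : Tendsto β atTop atTop)
    (μ : ℕ → Measure (LGConfig 4 G)) (hμ : ∀ k, μ k ∈ oddTorusLimitPoints r (β k))
    {n : ℕ} (hn : 2 ≤ n) (q : Fin n → Fin 4 × Fin 4) (hq : ∀ i, (q i).1 < (q i).2)
    (F : 𝓢((Fin n → EuclideanSpace ℝ (Fin 4)), ℂ)) (hF : IsOffDiagonal F) :
    Tendsto (fun k => ∑' x : Fin n → (Fin 4 → ℤ), ((stateMomentStr G r (μ k) n q x : ℝ) : ℂ) *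
        F (fun l => a (β k) • siteToE (x l) +
          (a (β k) / 2) • (EuclideanSpace.single (q l).1 (1 : ℝ) + EuclideanSpace.single (q l).2 (1 : ℝ))) -
      ∑' x : Fin n → (Fin 4 → ℤ), ((stateMomentStr G r (μ k) n q x : ℝ) : ℂ) * F (fun l => a (β k) • siteToE (x l)))
      atTop (𝓝 0) := by
  -- thresholds hold from some index `k₀` on
  obtain ⟨B₁, hB₁⟩ : ∃ B₁ : ℝ, ∀ b, B₁ ≤ b → a b < min (1 / 24) ℓ₄ :=
    Filter.eventually_atTop.1 (ha0.eventually (gt_mem_nhds (by positivity)))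
  obtain ⟨k₀, hk₀⟩ := Filter.eventually_atTop.1 (hβ.eventually (eventually_ge_atTop (max β₄ B₁)))
  -- the shifted sequences satisfy the hypotheses of the shift-defect lemma for all indices
  have hβ' : ∀ k, β₄ ≤ β (k + k₀) := fun k => le_trans (le_max_left _ _) (hk₀ _ (Nat.le_add_left _ _))
  have hB' : ∀ k, B₁ ≤ β (k + k₀) := fun k => le_trans (le_max_right _ _) (hk₀ _ (Nat.le_add_left _ _))
  have ha' : ∀ k, 0 < a (β (k + k₀)) := fun k => hapos _
  have ha24' : ∀ k, a (β (k + k₀)) ≤ 1 / 24 := fun k => (hB₁ _ (hB' k)).le.trans (min_le_left _ _)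
  have haℓ' : ∀ k, a (β (k + k₀)) ≤ ℓ₄ := fun k => (hB₁ _ (hB' k)).le.trans (min_le_right _ _)
  have ha0' : Tendsto (fun k => a (β (k + k₀))) atTop (𝓝 0) :=
    (ha0.comp hβ).comp (tendsto_add_atTop_nat k₀)
  have hc : ∀ (k : ℕ) (l : Fin n), ‖(a (β (k + k₀)) / 2) •
      (EuclideanSpace.single (q l).1 (1 : ℝ) + EuclideanSpace.single (q l).2 (1 : ℝ))‖ ≤ a (β (k + k₀)) :=
    fun k l => by
      rw [norm_smul, Real.norm_of_nonneg (by linarith [(ha' k).le] : (0 : ℝ) ≤ a (β (k + k₀)) / 2)]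
      have h1 : ‖EuclideanSpace.single (q l).1 (1 : ℝ) + EuclideanSpace.single (q l).2 (1 : ℝ)‖ ≤ 2 := by
        have e1 : ‖EuclideanSpace.single (q l).1 (1 : ℝ)‖ = 1 := by
          rw [show EuclideanSpace.single (q l).1 (1 : ℝ) = PiLp.single 2 (q l).1 (1 : ℝ) from rfl,
            PiLp.norm_single 2 (fun _ : Fin 4 => ℝ) (q l).1 (1 : ℝ), norm_one]
        have e2 : ‖EuclideanSpace.single (q l).2 (1 : ℝ)‖ = 1 := by
          rw [show EuclideanSpace.single (q l).2 (1 : ℝ) = PiLp.single 2 (q l).2 (1 : ℝ) from rfl,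
            PiLp.norm_single 2 (fun _ : Fin 4 => ℝ) (q l).2 (1 : ℝ), norm_one]
        calc _ ≤ ‖EuclideanSpace.single (q l).1 (1 : ℝ)‖ + ‖EuclideanSpace.single (q l).2 (1 : ℝ)‖ :=
              norm_add_le _ _
          _ = 2 := by rw [e1, e2]; norm_num
      nlinarith [(ha' k).le]
  have h := tendsto_tsum_shift_sub_base r Cn hℓ hC Hcol (fun k => β (k + k₀)) hβ' ha' ha24' haℓ' ha0'
    (fun k => μ (k + k₀)) (fun k => hμ _) hn q hq
    (fun k l => (a (β (k + k₀)) / 2) • (EuclideanSpace.single (q l).1 (1 : ℝ) + EuclideanSpace.single (q l).2 (1 : ℝ)))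
    hc F hF
  -- unshift the index
  rw [← tendsto_add_atTop_iff_nat k₀]
  exact h

/-- **Base-point convergence from centre convergence, per-order constants** (verbatim
`InfiniteVolume.tendsto_base_of_tendsto_centre`). [folklore] -/
theorem tendsto_base_of_tendsto_centre (r : LatticeRep G) {a : ℝ → ℝ} (hapos : ∀ β, 0 < a β)
    (ha0 : Tendsto a atTop (𝓝 0)) (Cn : ℕ → ℝ) {β₄ ℓ₄ : ℝ} (hℓ : 0 < ℓ₄) (hC : ∀ n, 0 ≤ Cn n)
    (Hcol : ∀ β : ℝ, β₄ ≤ β →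
      ∀ (L n : ℕ) (q : Fin n → Fin 4 × Fin 4) (x : Fin n → (Fin 4 → ℤ)) (R : ℕ), (∀ i, (q i).1 < (q i).2) →
        1 ≤ R → (R : ℝ) * a β ≤ ℓ₄ → 4 * R + 8 ≤ L →
        (∀ i j : Fin n, i ≠ j → ∃ k : Fin 4,
          (2 * (R : ℤ) + 4) ≤ |((((x i k - x j k : ℤ) : ZMod (2 * L + 1))).valMinAbs : ℤ)|) →
        |torusE G r β L (fun U => ∏ i, (plane G r (q i) (x i) U - torusE G r β L (plane G r (q i) (x i))))| ≤
          (Cn n / (R : ℝ) ^ 4) ^ n)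
    (β : ℕ → ℝ) (hβ : Tendsto β atTop atTop)
    (μ : ℕ → Measure (LGConfig 4 G)) (hμ : ∀ k, μ k ∈ oddTorusLimitPoints r (β k))
    {n : ℕ} (hn : 2 ≤ n) (q : Fin n → Fin 4 × Fin 4) (hq : ∀ i, (q i).1 < (q i).2)
    (F : 𝓢((Fin n → EuclideanSpace ℝ (Fin 4)), ℂ)) (hF : IsOffDiagonal F) {z : ℂ}
    (h : Tendsto (fun k => ∑' x : Fin n → (Fin 4 → ℤ), ((stateMomentStr G r (μ k) n q x : ℝ) : ℂ) *
        F (fun l => a (β k) • siteToE (x l) +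
          (a (β k) / 2) • (EuclideanSpace.single (q l).1 (1 : ℝ) + EuclideanSpace.single (q l).2 (1 : ℝ))))
        atTop (𝓝 z)) :
    Tendsto (fun k => ∑' x : Fin n → (Fin 4 → ℤ), ((stateMomentStr G r (μ k) n q x : ℝ) : ℂ) *
        F (fun l => a (β k) • siteToE (x l))) atTop (𝓝 z) := by
  have hd := tendsto_centre_sub_base_zero r hapos ha0 Cn hℓ hC Hcol β hβ μ hμ hn q hq F hF
  have h2 := h.sub hd
  rw [sub_zero] at h2
  refine h2.congr fun k => ?_
  simp only [sub_sub_cancel]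

end Summit.QuantumFields.YangMills.Theorems.InfiniteVolume.PerOrder

end
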